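import Summits.Ventures.CertifiedManyBodySolver.Downfold.EmeryBandJetWindow
import Summits.Ventures.CertifiedManyBodySolver.Downfold.EmeryFermiFillingHg1223IPSubs
import Summits.Ventures.CertifiedManyBodySolver.Downfold.EmeryFermiEnergyExistsAll
import HarnessLib

/-!
# THE WHOLE-BAND (OBJECT-M) ONE-BAND SET AS CERTIFIED WINDOWS — HgBa₂Ca₂Cu₃O₈₊δ inner plane (Hg-1223 IP), ν = 0.41, inner plane, sub-boxes 2_0: for EVERY member of each Δ_pd × t_pd sub-box the
# nodal-jet `(t_J, t′_J/t_J, t″_J/t_J)` of `EmeryBandJet` at the Fermi energy lies in the tabulated windows (INFL-3to1-B §B.101)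

Venture CertifiedManyBodySolver, cell `pub/hubbard-downfold` (stage S1; INFLATION-RULES-3to1-B §B.101), seat hubbard-downfold-mod-4 (technique B = band
level, g45); namespace `Summit.Ventures.CertifiedManyBodySolver.Downfold.Emery`. Everything PROVED (`decide +kernel` on the bisection certificates of
`EmeryBandJetWindow.jetLeaf` — slope arithmetic `EmerySlopeArith(Sound)` — composed with the sub-box ε_F brackets of `EmeryFermiFillingHg1223IPSubs` and
`abFilling_fermiEnergyOf'`; generator HOME/hubbard-downfold-mod-4/jet-g45/gen/emit_boxes2.py, bit-exact python mirror of the kernel checker).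
WHAT THIS IS NOT: a statement about HgBa₂Ca₂Cu₃O₈₊δ inner plane (Hg-1223 IP) — the typed box (box #35's inner-plane site-mean σ companion `emeryBoxHg1223IP` (HgBa₂Ca₂Cu₃O₈₊δ INNER plane; t_pp [0.6, 0.76] × t_pp′ [0.11, 0.22] eV)) is SCREENING-GRADE; `U = 0` one-body kinematics of the σ model; the ε_F coupling is per
SUB-BOX (each member's jet is bounded over its sub-box's certified ε_F bracket, not at its own ε_F), so the windows are OUTER bounds of the true ranges.

| Δ_pd | t_pd | ε_F bracket | leaf evaluations | t_J (eV) | t′_J/t_J | t″_J/t_J |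
|---|---|---|---|---|---|---|
| [1.625, 1.8225] | [1.16, 1.3] | [1.26, 2.1] | 837 | [0.2975, 0.5035] | [-0.1955, -0.0383] | [0.0642, 0.3417] |

Sources: [HybertsenSchluterChristensen1989, Eq. (1)]; [AndersenEtAl1995, §6]; [PavariniEtAl2001, Eq. (1)]; interval/slope arithmetic [folklore].
-/

noncomputable section

namespace Summit.Ventures.CertifiedManyBodySolver.Downfold.Emery

open Real Set Literature.Analysis.ValidatedNumerics.Numerics

/-! ## Bisection certificates (one `decide +kernel` per piece of the bisection tree) -/

set_option maxRecDepth 16384 in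
/-- Sub-box 2_0, piece 8 (h4l4; 97 leaf evaluations). [folklore] -/
theorem hg1223IPJet_2_0_c8 :
    Box5.deep (jetLeaf ⟨83738805571420, 141722650773816, -55028357946934, -10780491608018, 18070693504824, 96179999542032⟩) 40
      ⟨fiIcc 13 8 729 400, fiIcc 29 25 13 10, fiIcc 3 5 19 25, fiIcc 11 100 11 50, Box5.loHalf (Box5.hiHalf (fiIcc 63 50 21 10))⟩ = true := by
  decide +kernel

set_option maxRecDepth 16384 in
/-- Sub-box 2_0, piece 9 (h4h4; 75 leaf evaluations). [folklore] -/
theorem hg1223IPJet_2_0_c9 :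
    Box5.deep (jetLeaf ⟨83738805571420, 141722650773816, -55028357946934, -10780491608018, 18070693504824, 96179999542032⟩) 40
      ⟨fiIcc 13 8 729 400, fiIcc 29 25 13 10, fiIcc 3 5 19 25, fiIcc 11 100 11 50, Box5.hiHalf (Box5.hiHalf (fiIcc 63 50 21 10))⟩ = true := by
  decide +kernel

end Summit.Ventures.CertifiedManyBodySolver.Downfold.Emery
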